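import Summits.QuantumFields.YangMills.Theorems.BalabanUVNodesN15KingModelFullPropagatorGradHolderProfile

/-!
# BalabanUVNodes ∕ N15 — THE KING-MODEL RUNG, CURVED EDITION (PART U-c): THE C^{1,α} POWER LAW OF THE FULL `A = 0` FLUCTUATION PROPAGATOR —
# `(|x − x′|∕L^K)^{−α}·|∂^η_μG^η_K(x′, y) − ∂^η_μG^η_K(x, y)| ≤ C·((L^K)∕m)^d·((L^K)∕m)^α` (`m = dist({x, x′}, y) ≥ 1`) — King's Prop. 3.7 (3.65)
# DERIVATIVE clause `|(∂_α(x, x′)∇_μG)(y)| ≤ C·m^{1−(d+1)−α}` for the FULL propagator, UNIFORMLY in `K`, the volume and the mass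
# (Track A, DAG node N15 = NE2; FAN-OUT v1.1 §N15 s3 «KING-MODEL RUNG … + the one-line statement of what the curved case adds»)

HONEST FRAMING.  Count-neutral kernel bookkeeping (cell `pub-ymgap`, seat `pub-ymgap-dag-n15-e` g9; `--supports stmt-QuantumFields-20544
--as helper` = K3⁷ `SpineGivenEndpointR13SepCoPH`, WORDS-143).  TEMPLATE LITERATURE, `A = 0`: C. King's scalar U(1)-Higgs MODEL on finite tori ([King1986]
§2.2 p. 653 (2.13)–(2.17), Theorem 3.3 pp. 655–656 ((3.8) p. 656), (3.62) p. 663, Prop. 3.7 (3.65) p. 663 «|(∂_α(x, y)D^a_xD^b_zG_{(j)})(z)| ≤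
C(L^jη)^{2−d−|a|−|b|−α}exp[−δ₀(L^jη)^{−1}dist({x, y}, z)]»; King's `d` = this file's `d + 1`), NOT Bałaban's covariant objects; the power law below is the
(2.17)-SUMMED SHAPE of the derivative clause of (3.65) for King's (2.13) at `A = 0`, NOT a printed proposition; NE2⁺ is NOT PRINTED and not proved
here; NOT a node discharge; nothing continuum ∕ ℝ⁴ ∕ OS ∕ mass-gap ∕ Clay.  0 `sorry`, 0 `def`, standard axioms.

THE POINT.  Part U-b `fullPropD_holder_profile_unif` bounds the weighted Hölder difference of `∂G_μ` by the level sum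
`C·Σ_{i<K} (ΛL)^i(L^i)^α·e^{−δ·m·L^i∕L^K}`, `ΛL = L^d` (R-c `LamL_eq_pow`).  THIS FILE sums the levels:
* §1 `levelSum_rpow_le_powerLaw` — the level sum with the extra REAL power `(L^i)^α`, `0 ≤ α ≤ 1`:
  `Σ_{i<K} (L^p)^i(L^i)^α·e^{−δ·r·L^i∕L^K} ≤ (K_p + K_{p+1})·(L^K∕r)^p·(L^K∕r)^α` (`r ≥ 1`), by Bernoulli's inequality `(1 + s)^α ≤ 1 + αs ≤ 1 + s`
  applied to `(L^i·r∕L^K)^α`, which splits the sum into part R-b's integer-power level sums `levelSum_le_powerLaw` at `p` and at `p + 1`;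
* §2 ★★ **`fullPropD_holder_powerLaw_unif`** (`d ≥ 1`, `y ≠ x, x′`): `(ρ∕N)^{−α}·|∂G_μ(x′, y) − ∂G_μ(x, y)| ≤ C·((L^K)∕m)^d·((L^K)∕m)^α` — in unit
  coordinates `C·dist({x, x′}, y)^{1−(d+1)−α}`, the printed exponent `(L^jη)^{2−d−|a|−α}` of (3.65) at `|a| = 1` and the scale `L^jη ≈ dist`;
  ★ **`fullPropD_holder_dist_unif`** (the same unweighted, `x ≠ x′`): `|∂G_μ(x′, y) − ∂G_μ(x, y)| ≤ C·(ρ∕m)^α·((L^K)∕m)^d` — the C^{1,α} twin of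
  part T-b's `fullProp_holder_dist_unif` (`|G(x′, y) − G(x, y)| ≤ C(ρ∕m)^α((L^K)∕m)^{d−1}`).
With parts R (UV profile), S (η-rate profile), T (Hölder clause of `G`) this completes, for King's full `A = 0` propagator at the KERNEL level, the
(3.63)∕(3.65)-type estimates of order ≤ 1 + α in the observation point: `G ∈ C^{1,α}` off the source with the printed UV power laws.
WHAT THE CURVED CASE ADDS (one line): the same for `∇_UG_k(U)` uniformly over the live window `Reg335`.
HONEST SCOPE.  (i) `A = 0`, periodic b.c., odd `L ≥ 3`, `0 < m² ≤ m₀²`, cubes `2L^e`, `0 < α < 1`, `d ≥ 1`; (ii) lattice units of level `K`; sup torus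
distances; `m = min(|x − y|, |x′ − y|) ≥ 1` (the source off both observation points); (iii) no `α = 1` (not printed, not claimed), no second
derivatives (`G ∉ C²`: the averaging term jumps across block faces); (iv) not Bałaban's `∇G_k(U)`; not a discharge.
Locators: [King1986] C. King, CMP **102** (1986) 649–677: (2.13)–(2.17) p. 653, Theorem 3.3 p. 655, (3.8) p. 656, (3.62), Prop. 3.7 (3.65) p. 663;
[Ba 4] = [Balaban1983RegularityDecay] Theorem (1.9) p. 573.
-/

noncomputable section

namespace Summit.QuantumFields.YangMills.BalabanUVNodes.N15KingModelRung.Curved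

open Real Finset Matrix
open Literature.MathematicalPhysics.QuantumFieldTheory.Balaban1983to89.B5Prop11Plancherel (Tor fine unitVec)
open Literature.MathematicalPhysics.QuantumFieldTheory.King1986 (aK aK_pos)
open Literature.MathematicalPhysics.QuantumFieldTheory.King1986.Torus (constrainedProp tdistT tdistT_nonneg tdistT_symm)

variable {d : ℕ} (L : ℕ) [NeZero L]

/-! ## §1 The level sum with an extra real power -/

omit [NeZero L] in
/-- **The level sum with an extra real power** (`L ≥ 2` real, `δ > 0`, `p ≥ 1`, `0 ≤ α ≤ 1`, `r ≥ 1`):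
`Σ_{i<K} (L^p)^i·(L^i)^α·e^{−δ·r·L^i∕L^K} ≤ (K_p + K_{p+1})·(L^K∕r)^p·(L^K∕r)^α`, `K_q = (2(q+1)!∕(δ∕L)^{q+1} + 2)∕L^q` the constant of part R-b's
`levelSum_le_powerLaw` — by Bernoulli's inequality `(L^i·r∕L^K)^α ≤ 1 + α(L^i·r∕L^K − 1) ≤ 1 + L^i·r∕L^K` (`rpow_one_add_le_one_add_mul_self`), which
splits the sum into the integer-power level sums at `p` and at `p + 1`. [cite: King1986, Prop. 3.7 (3.65) p.663 (the summed shape); scale bookkeeping] -/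
theorem levelSum_rpow_le_powerLaw {Lr δ r : ℝ} (hL : 2 ≤ Lr) (hδ : 0 < δ) {p : ℕ} (hp : 1 ≤ p) {α : ℝ} (hα0 : 0 ≤ α)
    (hα1 : α ≤ 1) (K : ℕ) (hr : 1 ≤ r) :
    ∑ i ∈ Finset.range K, (Lr ^ p) ^ i * (Lr ^ i) ^ α * Real.exp (-(δ * (r * Lr ^ i / Lr ^ K)))
      ≤ ((2 * (p + 1).factorial / (δ / Lr) ^ (p + 1) + 2) / Lr ^ p
          + (2 * (p + 1 + 1).factorial / (δ / Lr) ^ (p + 1 + 1) + 2) / Lr ^ (p + 1))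
        * ((Lr ^ K / r) ^ p * (Lr ^ K / r) ^ α) := by
  have hL0 : 0 < Lr := by linarith
  have hr0 : 0 < r := by linarith
  have hN0 : 0 < Lr ^ K := pow_pos hL0 K
  -- `t = r∕L^K`, `R = L^K∕r = t⁻¹`
  set t : ℝ := r / Lr ^ K with htdef
  set R : ℝ := Lr ^ K / r with hRdef
  have ht0 : 0 < t := div_pos hr0 hN0
  have hR0 : 0 < R := div_pos hN0 hr0
  have htR : t * R = 1 := by rw [htdef, hRdef, div_mul_div_comm, mul_comm, div_self (by positivity)]
  have hRt : R = t⁻¹ := eq_inv_of_mul_eq_one_right htR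
  -- the two integer-power level sums (part R-b)
  have hSp := levelSum_le_powerLaw hL hδ hp K hr
  have hSp1 := levelSum_le_powerLaw hL hδ (by omega : 1 ≤ p + 1) K hr
  set Kp : ℝ := (2 * (p + 1).factorial / (δ / Lr) ^ (p + 1) + 2) / Lr ^ p with hKpdef
  set Kp1 : ℝ := (2 * (p + 1 + 1).factorial / (δ / Lr) ^ (p + 1 + 1) + 2) / Lr ^ (p + 1) with hKp1def
  -- termwise Bernoulli: `(L^i)^α ≤ t^{−α}·(1 + L^i·t)`
  have hterm : ∀ i ∈ Finset.range K,
      (Lr ^ p) ^ i * (Lr ^ i) ^ α * Real.exp (-(δ * (r * Lr ^ i / Lr ^ K)))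
        ≤ t ^ (-α) * ((Lr ^ p) ^ i * Real.exp (-(δ * (r * Lr ^ i / Lr ^ K)))
            + t * ((Lr ^ (p + 1)) ^ i * Real.exp (-(δ * (r * Lr ^ i / Lr ^ K))))) := by
    intro i _
    have ha0 : 0 < Lr ^ i := pow_pos hL0 i
    set e : ℝ := Real.exp (-(δ * (r * Lr ^ i / Lr ^ K))) with hedef
    have he0 : 0 < e := Real.exp_pos _
    -- `(L^i)^α = t^{−α}·(L^i·t)^α` and Bernoulli on `(L^i·t)^α`
    have hsplit : (Lr ^ i) ^ α = t ^ (-α) * (Lr ^ i * t) ^ α := by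
      rw [Real.mul_rpow ha0.le ht0.le, Real.rpow_neg ht0.le, ← mul_assoc, mul_comm ((t ^ α)⁻¹), mul_assoc,
        inv_mul_cancel₀ (Real.rpow_pos_of_pos ht0 α).ne', mul_one]
    have hbern : (Lr ^ i * t) ^ α ≤ 1 + Lr ^ i * t := by
      have hs : (-1 : ℝ) ≤ Lr ^ i * t - 1 := by linarith [mul_pos ha0 ht0]
      have h := rpow_one_add_le_one_add_mul_self hs hα0 hα1
      rw [add_sub_cancel] at h
      refine h.trans ?_
      have hx0 : 0 ≤ Lr ^ i * t := (mul_pos ha0 ht0).le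
      nlinarith
    have hpow : (Lr ^ p) ^ i * (Lr ^ i * t) = t * (Lr ^ (p + 1)) ^ i := by
      rw [pow_succ, mul_pow]; ring
    calc (Lr ^ p) ^ i * (Lr ^ i) ^ α * e = t ^ (-α) * ((Lr ^ i * t) ^ α * ((Lr ^ p) ^ i * e)) := by rw [hsplit]; ring
      _ ≤ t ^ (-α) * ((1 + Lr ^ i * t) * ((Lr ^ p) ^ i * e)) :=
          mul_le_mul_of_nonneg_left (mul_le_mul_of_nonneg_right hbern (by positivity)) (Real.rpow_nonneg ht0.le _)
      _ = t ^ (-α) * ((Lr ^ p) ^ i * e + t * ((Lr ^ (p + 1)) ^ i * e)) := by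
          congr 1
          calc (1 + Lr ^ i * t) * ((Lr ^ p) ^ i * e) = (Lr ^ p) ^ i * e + (Lr ^ p) ^ i * (Lr ^ i * t) * e := by ring
            _ = (Lr ^ p) ^ i * e + t * ((Lr ^ (p + 1)) ^ i * e) := by rw [hpow]; ring
  have htα : t ^ (-α) = R ^ α := by rw [hRt, Real.inv_rpow ht0.le, Real.rpow_neg ht0.le]
  calc ∑ i ∈ Finset.range K, (Lr ^ p) ^ i * (Lr ^ i) ^ α * Real.exp (-(δ * (r * Lr ^ i / Lr ^ K)))
      ≤ ∑ i ∈ Finset.range K, t ^ (-α) * ((Lr ^ p) ^ i * Real.exp (-(δ * (r * Lr ^ i / Lr ^ K)))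
            + t * ((Lr ^ (p + 1)) ^ i * Real.exp (-(δ * (r * Lr ^ i / Lr ^ K))))) := Finset.sum_le_sum hterm
    _ = t ^ (-α) * (∑ i ∈ Finset.range K, (Lr ^ p) ^ i * Real.exp (-(δ * (r * Lr ^ i / Lr ^ K)))
            + t * ∑ i ∈ Finset.range K, (Lr ^ (p + 1)) ^ i * Real.exp (-(δ * (r * Lr ^ i / Lr ^ K)))) := by
        rw [Finset.mul_sum, ← Finset.sum_add_distrib, Finset.mul_sum]
    _ ≤ t ^ (-α) * (Kp * R ^ p + t * (Kp1 * R ^ (p + 1))) := by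
        refine mul_le_mul_of_nonneg_left (add_le_add hSp (mul_le_mul_of_nonneg_left hSp1 ht0.le)) (Real.rpow_nonneg ht0.le _)
    _ = R ^ α * ((Kp + Kp1) * R ^ p) := by
        rw [htα, pow_succ, show t * (Kp1 * (R ^ p * R)) = Kp1 * R ^ p * (t * R) by ring, htR, mul_one]
        ring
    _ = (Kp + Kp1) * (R ^ p * R ^ α) := by ring

/-! ## §2 The C^{1,α} power law for the full propagator -/

/-- **THE C^{1,α} POWER LAW OF KING'S FULL `A = 0` FLUCTUATION PROPAGATOR** (`d ≥ 1`): for odd `L ≥ 3`, `a > 0`, a mass cap `m₀² ≥ 0` and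
`0 < α < 1` there is `C > 0` such that for EVERY `K ≥ 1` (spelling `N = L^K`), cube `2L^e`, mass `0 < m² ≤ m₀²`, direction `μ` and all fine points
`x, x′` and `y ≠ x, x′` at `m = min(|x − y|, |x′ − y|)` (`≥ 1`):
`(|x − x′|∕N)^{−α}·|∂G_μ(x′, y) − ∂G_μ(x, y)| ≤ C·((L^K)∕m)^d·((L^K)∕m)^α` — in unit coordinates `C·dist({x, x′}, y)^{1−(d+1)−α}`, the printed
exponent `(L^jη)^{2−d−|a|−α}` of Prop. 3.7 (3.65) at `|a| = 1` and the scale `L^jη ≈ dist({x, x′}, y)`, i.e. King's Theorem 3.3 (3.8) ∕ [Ba 4] (1.9)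
Hölder clause of the derivative at the KERNEL level with the UV power law, for the FULL propagator, UNIFORM in `K`, the volume and the mass
(part U-b `fullPropD_holder_profile_unif` + `levelSum_rpow_le_powerLaw` at `p = d`).
[cite: King1986, Theorem 3.3 p.655, (3.8) p.656, (3.62) p.663, Prop. 3.7 (3.65) p.663, (2.17) p.653; Balaban1983RegularityDecay, Theorem (1.9) p.573] -/
theorem fullPropD_holder_powerLaw_unif (hd : 1 ≤ d) (hLodd : Odd L) (hL : 2 ≤ L) {a : ℝ} (ha : 0 < a) {m0sq : ℝ}
    (hm0 : 0 ≤ m0sq) {α : ℝ} (hα0 : 0 < α) (hα1 : α < 1) :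
    ∃ C : ℝ, 0 < C ∧ ∀ (K : ℕ), 1 ≤ K → ∀ (N : ℕ) [NeZero N], N = L ^ K →
      ∀ (e : ℕ) (M : Fin (d + 1) → ℕ) [∀ μ, NeZero (M μ)], (∀ μ, M μ = 2 * L ^ e) →
      ∀ (msq : ℝ), 0 < msq → msq ≤ m0sq → ∀ (μ : Fin (d + 1)) (x x' y : Tor (fine N M)), x ≠ y → x' ≠ y →
        (tdistT (fine N M) x x' / (N : ℝ)) ^ (-α) *
          |((N : ℝ) * (constrainedProp N M (aK a L K) (((N : ℕ) : ℝ) ^ 2) msq (x' + unitVec (fine N M) μ) y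
              - constrainedProp N M (aK a L K) (((N : ℕ) : ℝ) ^ 2) msq x' y)
            - (N : ℝ) * (constrainedProp N M (aK a L K) (((N : ℕ) : ℝ) ^ 2) msq (x + unitVec (fine N M) μ) y
              - constrainedProp N M (aK a L K) (((N : ℕ) : ℝ) ^ 2) msq x y))|
          ≤ C * (((L : ℝ) ^ K / min (tdistT (fine N M) x y) (tdistT (fine N M) x' y)) ^ d
                * ((L : ℝ) ^ K / min (tdistT (fine N M) x y) (tdistT (fine N M) x' y)) ^ α) := by
  obtain ⟨C, δ, hC, hδ, H⟩ := fullPropD_holder_profile_unif (d := d) L hLodd hL ha hm0 hα0 hα1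
  have hLr : (2 : ℝ) ≤ L := by exact_mod_cast hL
  set Kp : ℝ := (2 * (d + 1).factorial / (δ / L) ^ (d + 1) + 2) / (L : ℝ) ^ d
      + (2 * (d + 1 + 1).factorial / (δ / L) ^ (d + 1 + 1) + 2) / (L : ℝ) ^ (d + 1) with hKp
  have hδL : 0 < δ / L := div_pos hδ (by positivity)
  have hKp0 : 0 < Kp := by positivity
  refine ⟨C * Kp, mul_pos hC hKp0, ?_⟩
  intro K hK N _ hN e M _ hM msq hmsq hcap μ x x' y hxy hx'y
  have h := H K hK N hN e M hM msq hmsq hcap μ x x' y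
  set m : ℝ := min (tdistT (fine N M) x y) (tdistT (fine N M) x' y) with hmdef
  have hm1 : 1 ≤ m := le_min (one_le_tdistT_of_ne (fine N M) hxy) (one_le_tdistT_of_ne (fine N M) hx'y)
  have hsum := levelSum_rpow_le_powerLaw hLr hδ hd hα0.le hα1.le K hm1
  have hN' : (N : ℝ) = (L : ℝ) ^ K := by rw [hN, Nat.cast_pow]
  have hsum' : ∑ i ∈ Finset.range K, ((L : ℝ) ^ d) ^ i * ((L : ℝ) ^ i) ^ α
        * Real.exp (-(δ * (m * (L : ℝ) ^ i / (N : ℝ))))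
      ≤ Kp * (((L : ℝ) ^ K / m) ^ d * ((L : ℝ) ^ K / m) ^ α) := by
    rw [hN']; exact hsum
  rw [LamL_eq_pow L hL] at h
  calc _ ≤ C * ∑ i ∈ Finset.range K, ((L : ℝ) ^ d) ^ i * ((L : ℝ) ^ i) ^ α
            * Real.exp (-(δ * (m * (L : ℝ) ^ i / (N : ℝ)))) := h
    _ ≤ C * (Kp * (((L : ℝ) ^ K / m) ^ d * ((L : ℝ) ^ K / m) ^ α)) := mul_le_mul_of_nonneg_left hsum' hC.le
    _ = C * Kp * (((L : ℝ) ^ K / m) ^ d * ((L : ℝ) ^ K / m) ^ α) := by ring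

/-- **THE SAME, UNWEIGHTED** — King's (3.65) derivative clause `|(∂_α(x, x′)∇_μG)(y)| ≤ C·dist({x, x′}, y)^{1−(d+1)−α}` solved for the difference
(`d ≥ 1`, `x ≠ x′`, `y ≠ x, x′`):  `|∂G_μ(x′, y) − ∂G_μ(x, y)| ≤ C·(|x − x′|∕m)^α·((L^K)∕m)^d`, `m = min(|x − y|, |x′ − y|)` — the C^{1,α} twin of
part T-b's `fullProp_holder_dist_unif` (`|G(x′, y) − G(x, y)| ≤ C(ρ∕m)^α((L^K)∕m)^{d−1}`), for the FULL `A = 0` propagator, uniformly in `K`, the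
volume and the mass. [cite: King1986, Theorem 3.3 p.655, (3.8) p.656, (3.62) p.663, Prop. 3.7 (3.65) p.663; Balaban1983RegularityDecay, Theorem (1.9) p.573] -/
theorem fullPropD_holder_dist_unif (hd : 1 ≤ d) (hLodd : Odd L) (hL : 2 ≤ L) {a : ℝ} (ha : 0 < a) {m0sq : ℝ}
    (hm0 : 0 ≤ m0sq) {α : ℝ} (hα0 : 0 < α) (hα1 : α < 1) :
    ∃ C : ℝ, 0 < C ∧ ∀ (K : ℕ), 1 ≤ K → ∀ (N : ℕ) [NeZero N], N = L ^ K →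
      ∀ (e : ℕ) (M : Fin (d + 1) → ℕ) [∀ μ, NeZero (M μ)], (∀ μ, M μ = 2 * L ^ e) →
      ∀ (msq : ℝ), 0 < msq → msq ≤ m0sq → ∀ (μ : Fin (d + 1)) (x x' y : Tor (fine N M)), x' ≠ x → x ≠ y → x' ≠ y →
        |((N : ℝ) * (constrainedProp N M (aK a L K) (((N : ℕ) : ℝ) ^ 2) msq (x' + unitVec (fine N M) μ) y
              - constrainedProp N M (aK a L K) (((N : ℕ) : ℝ) ^ 2) msq x' y)
            - (N : ℝ) * (constrainedProp N M (aK a L K) (((N : ℕ) : ℝ) ^ 2) msq (x + unitVec (fine N M) μ) y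
              - constrainedProp N M (aK a L K) (((N : ℕ) : ℝ) ^ 2) msq x y))|
          ≤ C * (tdistT (fine N M) x x' / min (tdistT (fine N M) x y) (tdistT (fine N M) x' y)) ^ α
              * ((L : ℝ) ^ K / min (tdistT (fine N M) x y) (tdistT (fine N M) x' y)) ^ d := by
  obtain ⟨C, hC, H⟩ := fullPropD_holder_powerLaw_unif (d := d) L hd hLodd hL ha hm0 hα0 hα1
  refine ⟨C, hC, ?_⟩
  intro K hK N _ hN e M _ hM msq hmsq hcap μ x x' y hxx hxy hx'y
  have h := H K hK N hN e M hM msq hmsq hcap μ x x' y hxy hx'y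
  set m : ℝ := min (tdistT (fine N M) x y) (tdistT (fine N M) x' y) with hmdef
  set ρ : ℝ := tdistT (fine N M) x x' with hρdef
  have hm1 : 1 ≤ m := le_min (one_le_tdistT_of_ne (fine N M) hxy) (one_le_tdistT_of_ne (fine N M) hx'y)
  have hm0' : 0 < m := by linarith
  have hρ1 : 1 ≤ ρ := by
    rw [hρdef, tdistT_symm]
    exact one_le_tdistT_of_ne (fine N M) hxx
  have hρ0 : 0 < ρ := by linarith
  have hL0 : (0 : ℝ) < L := by exact_mod_cast (show 0 < L by omega)
  have hN' : (N : ℝ) = (L : ℝ) ^ K := by rw [hN, Nat.cast_pow]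
  have hN0 : 0 < (N : ℝ) := by rw [hN']; exact pow_pos hL0 K
  have hNne : (N : ℝ) ≠ 0 := hN0.ne'
  set X : ℝ := |((N : ℝ) * (constrainedProp N M (aK a L K) (((N : ℕ) : ℝ) ^ 2) msq (x' + unitVec (fine N M) μ) y
              - constrainedProp N M (aK a L K) (((N : ℕ) : ℝ) ^ 2) msq x' y)
            - (N : ℝ) * (constrainedProp N M (aK a L K) (((N : ℕ) : ℝ) ^ 2) msq (x + unitVec (fine N M) μ) y
              - constrainedProp N M (aK a L K) (((N : ℕ) : ℝ) ^ 2) msq x y))| with hXdef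
  -- undo the weight: `X = (ρ∕N)^α·[(ρ∕N)^{−α}·X]`
  have hw : 0 < (ρ / (N : ℝ)) ^ α := Real.rpow_pos_of_pos (div_pos hρ0 hN0) α
  have hXw : X = (ρ / (N : ℝ)) ^ α * ((ρ / (N : ℝ)) ^ (-α) * X) := by
    rw [← mul_assoc, Real.rpow_neg (div_pos hρ0 hN0).le, mul_inv_cancel₀ hw.ne', one_mul]
  -- `(ρ∕N)^α·(N∕m)^α = (ρ∕m)^α`
  have hρm : (ρ / (N : ℝ)) ^ α * ((L : ℝ) ^ K / m) ^ α = (ρ / m) ^ α := by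
    rw [← hN', ← Real.mul_rpow (div_pos hρ0 hN0).le (div_pos hN0 hm0').le]
    congr 1
    rw [div_mul_div_comm, mul_comm ρ (N : ℝ), mul_div_mul_left ρ m hNne]
  rw [hXw]
  calc (ρ / (N : ℝ)) ^ α * ((ρ / (N : ℝ)) ^ (-α) * X)
      ≤ (ρ / (N : ℝ)) ^ α * (C * (((L : ℝ) ^ K / m) ^ d * ((L : ℝ) ^ K / m) ^ α)) := mul_le_mul_of_nonneg_left h hw.le
    _ = C * ((ρ / (N : ℝ)) ^ α * ((L : ℝ) ^ K / m) ^ α) * ((L : ℝ) ^ K / m) ^ d := by ring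
    _ = C * (ρ / m) ^ α * ((L : ℝ) ^ K / m) ^ d := by rw [hρm]

end Summit.QuantumFields.YangMills.BalabanUVNodes.N15KingModelRung.Curved
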